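import Mathlib
import Summits.CriticalPhenomena.CardyFormulaZ2.Theorems.CardyMagicRigidityNestingRigidityStaircaseIntegrability
import Summits.CriticalPhenomena.CardyFormulaZ2.Theorems.CardyMagicRigidityNestingRigidityUVExpMomentsCell
import Summits.CriticalPhenomena.CardyFormulaZ2.Theorems.CardyMagicRigidityNestingRigidityUVFarBiteScales
import Summits.CriticalPhenomena.CardyFormulaZ2.Theorems.CardyMagicRigidityNestingRigidityUVTiltTransferCollar
import Literature.Probability.Percolation.NestingPhaseEstimates
import Literature.Probability.Percolation.SiteNestingWeightIntegrable
import HarnessLib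

/-!
# UV assembly toolkit (crux `MagicFormulaT`, line `Sketch` v6, stub S5 `stub_uvAssembly`) — part 1/2

Crux `Summit.CriticalPhenomena.CardyFormulaZ2.Theses.CardyMagicRigidity.MagicFormulaT`
(stmt-CriticalPhenomena-4836), line `Sketch`, skeleton v6 (the UV split).  Stub S5 assembles "small loops are
negligible for the twisted nesting transform, uniformly in the mesh" on a lattice ensemble
`E ∈ latticeEnsembles` from the band moment bounds (S1, S2), the band centring (S3) and the pathwise split /
sandwich (S4a, S4b).  This first file collects the model-free tools of that assembly:

* §1 two elementary real inequalities (`uva_abs_mul_le`: `|x||y| ≤ (t/2)x² + y²/(2t)`;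
  `uva_sq_sub_one_le`: `(s − 1)² ≤ (l − 1)² + (u − 1)²` for `l ≤ s ≤ u`);
* §2 the phase bound `|θ_u| ≤ π C diam²` (`uva_abs_nestingPhase_le_sq`) and the resulting dominations of the
  band-restricted phase / squared phase (`uva_band_dom_sq`, `uva_band_dom_four`, `uva_band_vanish`);
* §3 lattice facts at fixed mesh on both ensembles: the phase is supported on the finitely many loops meeting
  `B̄(0, R)` (`uva_finite_support_nestingPhase`), the small-loop phase sum splits along `{< η} ⊔ {[η, r)}`
  (`uva_finsum_small_split`), integrability of the truncated weights and of inner statistics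
  (`uva_integrable_truncNestingWeight`, `uva_integrable_inner`), measurability of band products
  (`uva_measurable_bandProd`; for sums use `FirstMoment.measurable_finsum_loops_sep` directly).

No definition, no cited fact; everything from tree material (`finite_loops_meeting`,
`Staircase.measurable_finprod_loops_sep`, `FirstMoment.measurable_finsum_loops_sep`,
`UVFarBite.integrable_finsum_inner`, `NestingPhaseEstimates`, `SiteNestingWeightIntegrable`).
-/

noncomputable section

namespace Summit.CriticalPhenomena.CardyFormulaZ2.Cruxes.MagicFormulaT.LineSketch

open MeasureTheory Filter Set Metric
open scoped Real Topology BigOperators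
open Literature.Probability.RandomPlanarGeometry Literature.Probability.Percolation
  Literature.Probability.LatticeModels
open Summit.CriticalPhenomena.CardyFormulaZ2.Cruxes.NestingRigidity.RingCloudTomography
open Summit.CriticalPhenomena.CardyFormulaZ2.Cruxes.NestingRigidity.PositiveConeWeightDoubling

/-! ## §1 Two elementary real inequalities -/

/-- AM–GM with a free parameter: `|x| |y| ≤ (t/2) x² + y²/(2t)` for `t > 0`. -/
theorem uva_abs_mul_le (x y : ℝ) {t : ℝ} (ht : 0 < t) :
    |x| * |y| ≤ t / 2 * x ^ 2 + 1 / (2 * t) * y ^ 2 := by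
  have h2t : 0 < 2 * t := by positivity
  rw [show t / 2 * x ^ 2 + 1 / (2 * t) * y ^ 2 = (t ^ 2 * x ^ 2 + y ^ 2) / (2 * t) by
    field_simp]
  rw [le_div_iff₀ h2t]
  nlinarith [sq_nonneg (t * |x| - |y|), sq_abs x, sq_abs y, abs_nonneg x, abs_nonneg y]

/-- Convexity of the square distance to `1`: a number between `l` and `u` is no further from `1` than the
worse of the two endpoints, `(s − 1)² ≤ (l − 1)² + (u − 1)²`. -/
theorem uva_sq_sub_one_le {s l u : ℝ} (hl : l ≤ s) (hu : s ≤ u) :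
    (s - 1) ^ 2 ≤ (l - 1) ^ 2 + (u - 1) ^ 2 := by
  rcases le_total s 1 with hs | hs
  · nlinarith [sq_nonneg (u - 1)]
  · nlinarith [sq_nonneg (l - 1)]

/-- `exp (log 16 · n) = 16 ^ n`. -/
theorem uva_exp_log_sixteen_mul (n : ℕ) : Real.exp (Real.log 16 * n) = (16 : ℝ) ^ n := by
  rw [mul_comm, Real.exp_nat_mul, Real.exp_log (by norm_num)]

/-- `(2 ^ n)² · y ≤ (16 ^ n + y²)/2` (AM–GM for the top factor). -/
theorem uva_four_pow_mul_le (n : ℕ) (y : ℝ) :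
    ((2 : ℝ) ^ n) ^ 2 * y ≤ ((16 : ℝ) ^ n + y ^ 2) / 2 := by
  have h16 : ((2 : ℝ) ^ n) ^ 4 = (16 : ℝ) ^ n := by
    rw [← pow_mul, show (16 : ℝ) = 2 ^ 4 by norm_num, ← pow_mul, mul_comm]
  nlinarith [sq_nonneg (((2 : ℝ) ^ n) ^ 2 - y), h16]

/-! ## §2 Phase bounds and band dominations -/

section Phase

variable {f : ℂ → ℝ} {R C : ℝ}

/-- **`|θ_u| ≤ π C diam(u)²`**: the winding interior of a loop lies in the closed disc of radius `diam` about
any trace point (`abs_nestingPhase_le_mul_volume_closedBall_diam`). -/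
theorem uva_abs_nestingPhase_le_sq (hC : ∀ z, |f z| ≤ C) (hR : ∀ z, R < ‖z‖ → f z = 0)
    (u : UnbasedLoop ℂ) : |u.nestingPhase f| ≤ π * C * diam u.range ^ 2 := by
  obtain ⟨x, hx⟩ := u.range_nonempty
  have h := abs_nestingPhase_le_mul_volume_closedBall_diam hC hR u hx
  rw [TiltTransfer.volume_real_closedBall x diam_nonneg] at h
  linarith [h]

/-- Domination of the band-restricted phase by `(π C) · diam²`. -/
theorem uva_band_dom_sq (hC : ∀ z, |f z| ≤ C) (hR : ∀ z, R < ‖z‖ → f z = 0) (a b : ℝ)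
    (u : UnbasedLoop ℂ) :
    |(if a ≤ diam u.range ∧ diam u.range < b then u.nestingPhase f else 0)| ≤
      π * C * diam u.range ^ 2 := by
  split_ifs
  · exact uva_abs_nestingPhase_le_sq hC hR u
  · rw [abs_zero]
    have hC0 : 0 ≤ C := nonneg_of_abs_le hC
    positivity

/-- Domination of the band-restricted squared phase by `(π C)² · diam⁴`. -/
theorem uva_band_dom_four (hC : ∀ z, |f z| ≤ C) (hR : ∀ z, R < ‖z‖ → f z = 0) (a b : ℝ)
    (u : UnbasedLoop ℂ) :
    |(if a ≤ diam u.range ∧ diam u.range < b then u.nestingPhase f ^ 2 else 0)| ≤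
      (π * C) ^ 2 * diam u.range ^ 4 := by
  split_ifs
  · rw [abs_pow, show (π * C) ^ 2 * diam u.range ^ 4 = (π * C * diam u.range ^ 2) ^ 2 by ring]
    exact pow_le_pow_left₀ (abs_nonneg _) (uva_abs_nestingPhase_le_sq hC hR u) 2
  · rw [abs_zero]; positivity

/-- The band-restricted statistics vanish on the loops of diameter `≥ b`. -/
theorem uva_band_vanish {a b : ℝ} {u : UnbasedLoop ℂ} (h : b ≤ diam u.range) (v : ℝ) :
    (if a ≤ diam u.range ∧ diam u.range < b then v else 0) = 0 := by
  rw [if_neg]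
  exact fun hh ↦ absurd hh.2 (not_lt.2 h)

/-- The family `{0 ≤ diam < η}` is the family `{diam < η}`. -/
theorem uva_sep_band_zero (L : Set (UnbasedLoop ℂ)) (η : ℝ) :
    {u ∈ L | 0 ≤ diam u.range ∧ diam u.range < η} = {u ∈ L | diam u.range < η} := by
  ext u
  simp only [mem_setOf_eq, diam_nonneg, true_and]

end Phase

/-! ## §3 Lattice facts at fixed mesh, both ensembles -/

section Lattice

variable {f : ℂ → ℝ} {R C : ℝ}

/-- **The phase is supported on the finitely many loops meeting `B̄(0, R)`**: for every family cut out of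
the loops of `X_δ(ω)` by a predicate, its intersection with the support of `θ` is finite. -/
theorem uva_finite_support_nestingPhase : ∀ E ∈ latticeEnsembles, ∀ {δ : ℝ}, 0 < δ →
    (∀ z, R < ‖z‖ → f z = 0) → ∫ z, f z = 0 → ∀ (ω : E.Ω) (Q : UnbasedLoop ℂ → Prop),
      ({u ∈ (E.X δ ω).loops | Q u} ∩ Function.support fun u ↦ u.nestingPhase f).Finite := by
  intro E hE δ hδ hR h0 ω Q
  refine (ConeTilt.finite_loops_meeting E hE hδ ω R).subset ?_
  rintro u ⟨⟨hu, -⟩, hne⟩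
  refine ⟨hu, ?_⟩
  by_contra hdisj
  rw [Set.not_nonempty_iff_eq_empty] at hdisj
  exact hne (nestingPhase_eq_zero_of_disjoint hR h0 (Set.disjoint_iff_inter_eq_empty.2 hdisj))

/-- **Splitting the small-loop phase sum** along `{diam < r} = {diam < η} ⊔ {η ≤ diam < r}` (`η ≤ r`):
an identity between honest finite sums. -/
theorem uva_finsum_small_split : ∀ E ∈ latticeEnsembles, ∀ (f : ℂ → ℝ) (R : ℝ) {δ : ℝ}, 0 < δ →
    (∀ z, R < ‖z‖ → f z = 0) → ∫ z, f z = 0 → ∀ (ω : E.Ω) {η r : ℝ}, η ≤ r →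
      (∑ᶠ u ∈ {u ∈ (E.X δ ω).loops | Metric.diam u.range < r}, u.nestingPhase f) =
        (∑ᶠ u ∈ {u ∈ (E.X δ ω).loops | Metric.diam u.range < η}, u.nestingPhase f) +
          ∑ᶠ u ∈ {u ∈ (E.X δ ω).loops | η ≤ Metric.diam u.range ∧ Metric.diam u.range < r},
            u.nestingPhase f := by
  intro E hE f R δ hδ hR h0 ω η r hηr
  have hunion : {u ∈ (E.X δ ω).loops | diam u.range < r} =
      {u ∈ (E.X δ ω).loops | diam u.range < η} ∪
        {u ∈ (E.X δ ω).loops | η ≤ diam u.range ∧ diam u.range < r} := by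
    ext u
    simp only [mem_setOf_eq, mem_union]
    constructor
    · rintro ⟨hu, hr'⟩
      rcases lt_or_ge (diam u.range) η with h | h
      · exact Or.inl ⟨hu, h⟩
      · exact Or.inr ⟨hu, h, hr'⟩
    · rintro (⟨hu, h⟩ | ⟨hu, -, h⟩)
      · exact ⟨hu, h.trans_le hηr⟩
      · exact ⟨hu, h⟩
  have hdisj : Disjoint {u ∈ (E.X δ ω).loops | diam u.range < η}
      {u ∈ (E.X δ ω).loops | η ≤ diam u.range ∧ diam u.range < r} := by
    rw [Set.disjoint_left]
    rintro u ⟨-, h⟩ ⟨-, h', -⟩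
    exact absurd h (not_lt.2 h')
  rw [hunion]
  exact finsum_mem_union' hdisj (uva_finite_support_nestingPhase E hE hδ hR h0 ω _)
    (uva_finite_support_nestingPhase E hE hδ hR h0 ω _)

/-- **Integrability of the truncated weight `A^ε_f(X_δ)` on both lattices at every mesh `δ > 0`**
(bounded by `2^{N(δ)}` and measurable: `SiteNestingWeightIntegrable`). -/
theorem uva_integrable_truncNestingWeight : ∀ E ∈ latticeEnsembles, ∀ {δ : ℝ}, 0 < δ →
    (∀ z, R < ‖z‖ → f z = 0) → ∫ z, f z = 0 → ∀ ε : ℝ,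
      Integrable (fun ω ↦ (E.X δ ω).truncNestingWeight f ε) E.P := by
  intro E hE δ hδ hR h0 ε
  haveI := isProbabilityMeasure_of_mem hE
  simp only [latticeEnsembles, Set.mem_insert_iff, Set.mem_singleton_iff] at hE
  rcases hE with rfl | rfl
  · exact Integrable.mono' (integrable_const _)
      (measurable_truncNestingWeight_bondLoopConfig _ ε δ).aestronglyMeasurable
      (Eventually.of_forall fun ω ↦ by
        rw [Real.norm_eq_abs]; exact abs_truncNestingWeight_bondLoopConfig_le hR h0 hδ ε ω)
  · exact integrable_truncNestingWeight_siteLoopConfig hR h0 hδ ε (triSitePercolation half)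

/-- **Integrability of a bounded inner statistic** `Σ_{u ⊆ D} g u`, `|g u| ≤ κ diam^p` on the loops inside
`D ⊆ B(x₀, ρ)` (there `diam ≤ 2ρ`), on both lattices at every mesh `δ > 0`. -/
theorem uva_integrable_inner : ∀ E ∈ latticeEnsembles, ∀ {δ : ℝ}, 0 < δ → ∀ (x₀ : ℂ) {ρ κ : ℝ}
    (p : ℕ) (D : Set ℂ) (g : UnbasedLoop ℂ → ℝ), 0 ≤ ρ → 0 ≤ κ → D ⊆ ball x₀ ρ →
    (∀ u : UnbasedLoop ℂ, u.range ⊆ D → |g u| ≤ κ * diam u.range ^ p) →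
      Integrable (fun ω ↦ ∑ᶠ u ∈ {u ∈ (E.X δ ω).loops | u.range ⊆ D}, g u) E.P := by
  intro E hE δ hδ x₀ ρ κ p D g hρ hκ hD hg
  have h := UVFarBite.integrable_finsum_inner E hE hδ D x₀ ρ (fun _ ↦ True) g
    (b := κ * (2 * ρ) ^ p) (by positivity) hD (fun u hu _ ↦ (hg u hu).trans (by
      gcongr
      exact UVFarBite.diam_le_two_mul hρ (hu.trans hD)))
  simpa only [and_true] using h

/-- **Measurability of a band product** `ω ↦ ∏ᶠ_{u ∈ X_δ(ω), Q u} w_u` on both lattices (in particular of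
the truncated weights and of the small-loop product). -/
theorem uva_measurable_bandProd : ∀ E ∈ latticeEnsembles, ∀ (δ : ℝ) (Q : UnbasedLoop ℂ → Prop),
    Measurable fun ω ↦ ∏ᶠ u ∈ {u ∈ (E.X δ ω).loops | Q u}, u.nestingFactor f :=
  fun E hE δ Q ↦ Staircase.measurable_finprod_loops_sep E hE δ Q _

/-- The top count is dominated by the K6-meet count over the larger ball `B̄(0, max |R| 1)`. -/
theorem uva_ncard_top_le : ∀ E ∈ latticeEnsembles, ∀ {δ : ℝ}, 0 < δ → ∀ (ω : E.Ω) (R r : ℝ),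
    {u ∈ (E.X δ ω).loops | (u.range ∩ closedBall (0 : ℂ) R).Nonempty ∧ r ≤ diam u.range}.ncard ≤
      {u ∈ (E.X δ ω).loops | (u.range ∩ closedBall (0 : ℂ) (max |R| 1)).Nonempty ∧
        r ≤ diam u.range}.ncard := by
  intro E hE δ hδ ω R r
  refine Set.ncard_le_ncard ?_ ((ConeTilt.finite_loops_meeting E hE hδ ω (max |R| 1)).subset ?_)
  · rintro u ⟨hu, ⟨z, hz, hzR⟩, hr⟩
    exact ⟨hu, ⟨z, hz, closedBall_subset_closedBall ((le_abs_self R).trans (le_max_left _ _)) hzR⟩,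
      hr⟩
  · rintro u ⟨hu, hne, -⟩
    exact ⟨hu, hne⟩

end Lattice

end Summit.CriticalPhenomena.CardyFormulaZ2.Cruxes.MagicFormulaT.LineSketch

end
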